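import Summits.AtomisticToContinuum.Crystallization.Theorems.FrustratedLawDichotomyCellF1Symm
import Summits.AtomisticToContinuum.Crystallization.Theorems.FrustratedLawDichotomyCellF1cLabels

/-!
# FrustratedLawDichotomy · crux `AperiodicFrustratedLawGap` (stmt-AtomisticToContinuum-27623) — class-A K-file tower, layer 2f-c:
the D4h-SYMMETRY hypotheses and the NASH ROW FROM REPRESENTATIVES over the COMPLETE template `MF1c` (KFILE amendment E2/E4, critic r1861; hand-2 g48)

#91 `…CellF1Symm` RE-BASED on #106 `MF1c` (closure `hMc` of #106; the strain cell `BF1`, `Stab16`, the representatives `rep16`/`symOf16` and the generic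
(272) `nn_of_reps` are untouched): `admLc_rep16` / `rep16_mem_Mc` (representatives of complete labels are complete labels), `ha_F1c` (template
equivariance over `MF1c`), `hnb_F1c` / `hnbI_F1c` (integer-ball near lists INSIDE `MF1c` are carried along by `Stab16`), and ★ `nn_of_reps_F1c` — the F1
NASH row over the complete template from per-representative readings (near list `nb := ballL MF1c zT ℓn`; only the multiplier table with its
equivariance, the representative set of `MN` and the readings remain as hypotheses).
Imports TREE #91 `…CellF1Symm` + #106 `…CellF1cLabels`; 0 sorry.  Tags: [new: K-file layer]; nothing here closes an item.
-/

namespace Summit.AtomisticToContinuum.Crystallization.Theorems.FrustratedLawDichotomyCellF1cSymm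

open scoped BigOperators RealInnerProductSpace
open Summit.AtomisticToContinuum.Crystallization.Theorems.ChargedEnergyGapNegative (E3)
open Summit.AtomisticToContinuum.Crystallization.Theorems.FrustratedLawDichotomyCoherentFloorAlgebra (psiT)
open Summit.AtomisticToContinuum.Crystallization.Theorems.FrustratedLawDichotomyCellTails (certCoeffNearL)
open Summit.AtomisticToContinuum.Crystallization.Theorems.FrustratedLawDichotomyCellMetric (posL)
open Summit.AtomisticToContinuum.Crystallization.Theorems.FrustratedLawDichotomyCellClasses (ballL)
open Summit.AtomisticToContinuum.Crystallization.Theorems.FrustratedLawDichotomyCellTriples (zT)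
open Summit.AtomisticToContinuum.Crystallization.Theorems.FrustratedLawDichotomyCellSymm (nn_of_reps)
open Summit.AtomisticToContinuum.Crystallization.Theorems.FrustratedLawDichotomyCellSymmZ3 (actZ)
open Summit.AtomisticToContinuum.Crystallization.Theorems.FrustratedLawDichotomyCellStab16
  (RZ Rr rep16 symOf16 act_inj ballL_eq nearId_mul exists_act_rep16)
open Summit.AtomisticToContinuum.Crystallization.Theorems.FrustratedLawDichotomyCellF1Frame (T a_act qk qk_act)
open Summit.AtomisticToContinuum.Crystallization.Theorems.FrustratedLawDichotomyCellF1Labels (MIF1 hMI)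
open Summit.AtomisticToContinuum.Crystallization.Theorems.FrustratedLawDichotomyCellF1cLabels (MF1c admLc admLc_act mem_Mc MI_subset_Mc hMc)
open Summit.AtomisticToContinuum.Crystallization.Theorems.FrustratedLawDichotomyCellF1Symm (BF1 hB_F1)
open Summit.AtomisticToContinuum.Crystallization.Theorems.FrustratedLawDichotomyCellF1Reps (hcov_of_subset)

/-- admissibility is constant on `Stab16`-orbits, read at the representative. -/
theorem admLc_rep16 (m : ℤ × ℤ × ℤ) : admLc (rep16 m) = admLc m := by
  obtain ⟨k, hk⟩ := exists_act_rep16 m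
  conv_rhs => rw [← hk]
  rw [admLc_act]

/-- … hence representatives of complete labels are complete labels. -/
theorem rep16_mem_Mc {m : ℤ × ℤ × ℤ} (hm : m ∈ MF1c) : rep16 m ∈ MF1c := mem_Mc.mpr (by rw [admLc_rep16]; exact mem_Mc.mp hm)

/-- (ha) on `MF1c`: template equivariance (layer 1, in the binder's shape). -/
theorem ha_F1c : ∀ k : Fin 16, ∀ x ∈ MF1c, (T.mulVec fun j => (zT (actZ (RZ k) x) j : ℝ)) = (Rr k).mulVec (T.mulVec fun j => (zT x j : ℝ)) :=
  fun k x _ => a_act k x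

/-- (hnb) integer-ball near lists about labels of `MF1c` are carried along by `Stab16`. -/
theorem hnb_F1c (ℓ : ℤ) : ∀ k : Fin 16, ∀ m ∈ MF1c, ballL MF1c zT ℓ (actZ (RZ k) m) = (ballL MF1c zT ℓ m).image (actZ (RZ k)) :=
  fun k => ballL_eq k (hMc k) ℓ

/-- (hnbh) the same over the interior `MIF1 ⊆ MF1c`. -/
theorem hnbI_F1c (ℓ : ℤ) : ∀ k : Fin 16, ∀ m ∈ MIF1, ballL MF1c zT ℓ (actZ (RZ k) m) = (ballL MF1c zT ℓ m).image (actZ (RZ k)) :=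
  fun k m hm => ballL_eq k (hMc k) ℓ m (MI_subset_Mc hm)

/-- ★ THE F1 NASH ROW OVER THE COMPLETE TEMPLATE FROM REPRESENTATIVES: only the multiplier table (with its equivariance), the representative set of the near
list `MN` and the per-representative readings over the cell remain as hypotheses; near list `nb := ballL MF1c zT ℓn`. -/
theorem nn_of_reps_F1c {ω : ℤ × ℤ × ℤ → Fin 3 → ℝ} (hω : ∀ k : Fin 16, ∀ x ∈ MIF1, ω (actZ (RZ k) x) = (Rr k).mulVec (ω x))
    (ℓn : ℤ) {MN Reps : Finset (ℤ × ℤ × ℤ)} (hReps : Reps ⊆ MF1c) (hR : ∀ m ∈ MN, rep16 m ∈ Reps) (nnTab : ℤ × ℤ × ℤ → ℝ)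
    (hrep : ∀ F ∈ BF1, ∀ m₀ ∈ Reps, ‖psiT (‖posL F (T.mulVec fun j => (zT m₀ j : ℝ))‖ ^ 2) • posL F (T.mulVec fun j => (zT m₀ j : ℝ))
        - certCoeffNearL MF1c MIF1 (fun x => posL F (T.mulVec fun j => (zT x j : ℝ))) (fun x => posL F (ω x)) (ballL MF1c zT ℓn) m₀‖
        ≤ nnTab m₀) :
    ∀ F ∈ BF1, ∀ m ∈ MN, ‖psiT (‖posL F (T.mulVec fun j => (zT m j : ℝ))‖ ^ 2) • posL F (T.mulVec fun j => (zT m j : ℝ))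
        - certCoeffNearL MF1c MIF1 (fun x => posL F (T.mulVec fun j => (zT x j : ℝ))) (fun x => posL F (ω x)) (ballL MF1c zT ℓn) m‖
        ≤ nnTab (rep16 m) :=
  nn_of_reps (B := BF1) (Rr := Rr) (Pk := fun k => actZ (RZ k)) (a := fun m => T.mulVec fun j => (zT m j : ℝ)) (symOf := symOf16)
    hB_F1 act_inj hMc hMI MI_subset_Mc (hnb_F1c ℓn) ha_F1c hω hReps (hcov_of_subset hR) nnTab hrep

end Summit.AtomisticToContinuum.Crystallization.Theorems.FrustratedLawDichotomyCellF1cSymm
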